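/-
Origin: expansion seat `prover-pub-hodgecm-mc-binder-2-g7-0`, handover #16 19:35Z md5 b3da4fa4ebb8 (132 l.; imports #15 only — INSTALL AFTER #15, DROP-ONLY-THIS-ROW on bounce; dictionary at the ι₁ place and at D₁₂ places: `planeToDPIdx eA eR q₀ S'` (`z_{aj} ↦ (eA a, eR j)`, `w_j ↦ (q₀, eR j)`), `diagCircleUnitary eR t`, `iotaTorusLetter t = ((1,1),(diag(t₁,t₂),1))`, `linSubst_star_dualPairι_iota_rename_z` (`z_{aj} ↦ t_j z_{aj}`), **`linSubst_star_dualPairι_iota_rename_detZ`** (`= (t₁t₂) • rename ι detZ`) and `…_eq_columnSubst` (= `rename ι (columnSubst (diag(t₁,t₂)) detZ)`, pv12's printed column action `ofPrintICircle`), `unitaryOpPi_dualPairι_iota_binvPi_detZ` (Schwartz form), D₁₂: `linSubst_one`, `unitaryOpPi_binvPi_one` (the printed vacuum `1` is fixed by every compact letter); mirror `lean -o` rc 0 / 0 warn; axioms trio (`g7/certs/IotaDictionary_mirror.txt`)) (`HOME/mc/pub-hodgecm-mc-binder-2/g7/pkg/HodgeCM/Model/HypCensus/IotaDictionary.lean`,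 md5 b3da4fa4, 132 lines);
landed by the gen-13 packager (p-g13) in gate run 37 as `HodgeCM/Model/HypCensus/IotaDictionary.lean` (verbatim).
-/
/-
Origin: speedrun cell pub-hodgecm, MODEL-CONSTRUCTION sub-cell, lineage mc-binder-2 (rows A12/A34 of the binder ledger:
`hyp12` / `hyp34`), seat prover-pub-hodgecm-mc-binder-2-g7-0 (gen 7), 2026-08-19.  Target in PKG:
`HodgeCM/Model/HypCensus/IotaDictionary.lean` (NEW additive leaf; imports this lineage's `KTypeDictionary` only; PKG `PerL34.ArchB` /
`ArchCFock` are below it).  KERNEL only.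
-/
import Summits.HodgeConjecture.HodgeCM.Model.HypCensus.KTypeDictionary

/-!
# Census kit (rows A12/A34), dictionary at the places of type `ι₁` and `D₁₂`: the torus acts on the printed line as in the kernel

At the place under `ι₁` (`V = U(2,1)`, `W` definite of rank 2) the printed local vector is `det(z)` (pv12 `kappaPartI = ℂ·detZ`,
PerL v5 ll. 506–510), the printed torus acts through the COLUMNS, `z_{aj} ↦ t_j z_{aj}` (`ofPrintICircle`: `columnSubst (diag(t₁,t₂))`,
eigenvalue `vac t · t₁ t₂`, `printLoc_χ_iota`); at a place of type `D₁₂` the printed vector is the vacuum `1` (`kappaPartE = ℂ·1`).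
Kernel side (`TorusBlock`, #9): `κOp e k = vacScalar e k • unitaryOpPi (dualPairι k)`, `unitaryOpPi U (binvPi F) = binvPi (linSubst (star U) F)`.

* §1 `planeToDPIdx eA eR q₀ : PlaneVar → DPIdx P' Q' R' S'` (`z_{aj} ↦ (eA a, eR j)` same-sign, `w_j ↦ (q₀, eR j)` mixed `Q × R`);
  `diagCircleUnitary eR t : unitaryGroup R' ℂ` (`diag(t₁,t₂)` through `eR`), the `W`-torus letter `iotaTorusLetter`;
* §2 **`linSubst_star_dualPairι_iota_rename_z`**: `z_{aj} ↦ t_j z_{aj}` in the kernel too, and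
  **`linSubst_star_dualPairι_iota_rename_detZ`**: `linSubst (star (dualPairι k_t)) (rename ι detZ) = (t₁ t₂) • rename ι detZ`
  = `rename ι (columnSubst (diag(t₁,t₂)) detZ)` (pv12 `columnSubst_detZ`, `det (diag(t₁,t₂)) = t₁ t₂`) — the printed torus action on the
  printed line IS the kernel one; **`unitaryOpPi_dualPairι_iota_binvPi_detZ`** the Schwartz form;
* §3 type `D₁₂`: **`linSubst_one`/`unitaryOpPi_binvPi_one`** — every letter fixes the vacuum `binvPi 1`.

So at EVERY real place the printed torus action is identified with the kernel's; `omg_ins` is reduced to the scalar read-off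
`vac_b t · (polynomial weight) = vacScalar e_b (letter t)` (VacReadOff).  Nothing here is a claim of PerL/QW8.  Style lint: no `local notation`.
-/

set_option autoImplicit false

noncomputable section

open MvPolynomial Complex
open scoped BigOperators ComplexConjugate Kronecker
open Literature.Analysis.SegalBargmann
open Literature.RepresentationTheory.KonnoKonno2007 Literature.RepresentationTheory.KonnoKonno2007.RealDualPair
open HodgeCM.PerL34.Fock HodgeCM.PerL34.Fock.PrintDict

namespace HodgeCM.Model.HypCensus

section IotaDict

variable {P' Q' R' S' : Type} [Fintype P'] [DecidableEq P'] [Fintype Q'] [DecidableEq Q'] [Fintype R'] [DecidableEq R']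
  [Fintype S'] [DecidableEq S']
variable (eA : Fin 2 ≃ P') (eR : Fin 2 ≃ R') (q₀ : Q')

/-! ## §1 The identification of variables and the torus letter at `ι₁` -/

/-- **the printed `ι₁` variables in Konno–Konno's block index**: `z_{aj} ↦ (eA a, eR j)` (block `P × R`), `w_j ↦ (q₀, eR j)` (block `Q × R`). -/
def planeToDPIdx (S' : Type) : HodgeCM.PerL34.Fock.PlaneVar → DPIdx P' Q' R' S'
  | Sum.inl (a, j) => Sum.inl (Sum.inl (eA a, eR j))
  | Sum.inr j => Sum.inr (Sum.inr (q₀, eR j))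

omit [Fintype P'] [DecidableEq P'] [Fintype Q'] [DecidableEq Q'] [Fintype R'] [DecidableEq R'] [Fintype S'] [DecidableEq S'] in
/-- (Ported verbatim from the HodgeCMPerL package; no docstring in the source.) -/
@[simp] theorem planeToDPIdx_z (a j : Fin 2) :
    planeToDPIdx eA eR q₀ S' (Sum.inl (a, j)) = Sum.inl (Sum.inl (eA a, eR j)) := rfl

/-- `diag(t₁, t₂)` on `R'` through `eR`. -/
def diagCircleUnitary (t : Circle × Circle) : Matrix.unitaryGroup R' ℂ :=
  ⟨Matrix.diagonal fun r => ((![t.1, t.2] (eR.symm r) : Circle) : ℂ), by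
    rw [Matrix.mem_unitaryGroup_iff, Matrix.star_eq_conjTranspose, Matrix.diagonal_conjTranspose, Matrix.diagonal_mul_diagonal,
      ← Matrix.diagonal_one]
    congr 1; funext r
    rw [Pi.star_apply, Complex.star_def, Complex.mul_conj, Circle.normSq_coe, Complex.ofReal_one]⟩

/-- (Ported verbatim from the HodgeCMPerL package; no docstring in the source.) -/
@[simp] theorem coe_diagCircleUnitary (t : Circle × Circle) :
    ((diagCircleUnitary eR t : Matrix.unitaryGroup R' ℂ) : Matrix R' R' ℂ) =
      Matrix.diagonal fun r => ((![t.1, t.2] (eR.symm r) : Circle) : ℂ) := rfl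

/-- **the `W`-torus letter at `ι₁`**: `((1,1),(diag(t₁,t₂), 1))`. -/
def iotaTorusLetter (t : Circle × Circle) : DPK P' Q' R' S' := ((1, 1), (diagCircleUnitary eR t, 1))

/-! ## §2 The printed line `det(z)` under the torus letter -/

omit [Fintype Q'] [DecidableEq Q'] in
/-- `z_{aj} ↦ t_j z_{aj}` in the kernel's substitution. [folklore] -/
theorem linSubst_star_dualPairι_iota_rename_z [Fintype Q'] [DecidableEq Q'] (t : Circle × Circle) (a j : Fin 2) :
    linSubst (star ((dualPairι (iotaTorusLetter eR t : DPK P' Q' R' S') : Matrix.unitaryGroup (DPIdx P' Q' R' S') ℂ) :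
        Matrix (DPIdx P' Q' R' S') (DPIdx P' Q' R' S') ℂ)) (rename (planeToDPIdx eA eR q₀ S') (HodgeCM.PerL34.Fock.z a j)) =
      C ((![t.1, t.2] j : Circle) : ℂ) * rename (planeToDPIdx eA eR q₀ S') (HodgeCM.PerL34.Fock.z a j) := by
  rw [HodgeCM.PerL34.Fock.z, rename_X, planeToDPIdx_z, iotaTorusLetter, linSubst_star_dualPairι_X_PR_general]
  simp only [OneMemClass.coe_one, Matrix.one_apply, coe_diagCircleUnitary, Matrix.diagonal_apply, ite_mul, one_mul, zero_mul,
    mul_ite, mul_zero, apply_ite C, map_zero, Finset.sum_ite_eq', Finset.mem_univ, if_true,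
    Equiv.symm_apply_apply]

omit [Fintype Q'] [DecidableEq Q'] in
/-- **the printed line transforms by `t₁ t₂`** under the kernel's torus letter:
`linSubst (star (dualPairι k_t)) (rename ι detZ) = (t₁ t₂) • rename ι detZ`. [folklore; pv12 `columnSubst_detZ`] -/
theorem linSubst_star_dualPairι_iota_rename_detZ [Fintype Q'] [DecidableEq Q'] (t : Circle × Circle) :
    linSubst (star ((dualPairι (iotaTorusLetter eR t : DPK P' Q' R' S') : Matrix.unitaryGroup (DPIdx P' Q' R' S') ℂ) :
        Matrix (DPIdx P' Q' R' S') (DPIdx P' Q' R' S') ℂ)) (rename (planeToDPIdx eA eR q₀ S') HodgeCM.PerL34.Fock.detZ) =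
      ((t.1 : ℂ) * (t.2 : ℂ)) • rename (planeToDPIdx eA eR q₀ S') HodgeCM.PerL34.Fock.detZ := by
  simp only [HodgeCM.PerL34.Fock.detZ, map_sub, map_mul, linSubst_star_dualPairι_iota_rename_z, smul_eq_C_mul, map_mul,
    Matrix.cons_val_zero, Matrix.cons_val_one]
  ring

omit [Fintype Q'] [DecidableEq Q'] in
/-- … which is pv12's printed column action: `= rename ι (columnSubst (diag(t₁,t₂)) detZ)`. -/
theorem linSubst_star_dualPairι_iota_rename_detZ_eq_columnSubst [Fintype Q'] [DecidableEq Q'] (t : Circle × Circle) :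
    linSubst (star ((dualPairι (iotaTorusLetter eR t : DPK P' Q' R' S') : Matrix.unitaryGroup (DPIdx P' Q' R' S') ℂ) :
        Matrix (DPIdx P' Q' R' S') (DPIdx P' Q' R' S') ℂ)) (rename (planeToDPIdx eA eR q₀ S') HodgeCM.PerL34.Fock.detZ) =
      rename (planeToDPIdx eA eR q₀ S') (columnSubst (Matrix.diagonal ![(t.1 : ℂ), (t.2 : ℂ)]) HodgeCM.PerL34.Fock.detZ) := by
  rw [linSubst_star_dualPairι_iota_rename_detZ, columnSubst_detZ, map_smul, Matrix.det_diagonal, Fin.prod_univ_two,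
    Matrix.cons_val_zero, Matrix.cons_val_one, Matrix.cons_val_fin_one]

omit [Fintype Q'] [DecidableEq Q'] in
/-- **Schwartz form**: `unitaryOpPi (dualPairι k_t) (binvPi (rename ι detZ)) = (t₁ t₂) • binvPi (rename ι detZ)`.
[Folland1989, Prop. (4.39)] -/
theorem unitaryOpPi_dualPairι_iota_binvPi_detZ [Fintype Q'] [DecidableEq Q'] (t : Circle × Circle) :
    unitaryOpPi (dualPairι (iotaTorusLetter eR t : DPK P' Q' R' S') : Matrix.unitaryGroup (DPIdx P' Q' R' S') ℂ)
        (binvPi (rename (planeToDPIdx eA eR q₀ S') HodgeCM.PerL34.Fock.detZ)) =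
      ((t.1 : ℂ) * (t.2 : ℂ)) • binvPi (rename (planeToDPIdx eA eR q₀ S') HodgeCM.PerL34.Fock.detZ) := by
  rw [unitaryOpPi_binvPi, linSubst_star_dualPairι_iota_rename_detZ, ← binvPiₗ_apply, ← binvPiₗ_apply, map_smul]

/-! ## §3 Type `D₁₂`: every letter fixes the vacuum -/

omit [DecidableEq P'] [DecidableEq Q'] [DecidableEq R'] [DecidableEq S'] in
/-- the substitution fixes constants: `linSubst M 1 = 1`. -/
theorem linSubst_one (M : Matrix (DPIdx P' Q' R' S') (DPIdx P' Q' R' S') ℂ) :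
    linSubst M (1 : MvPolynomial (DPIdx P' Q' R' S') ℂ) = 1 := map_one _

/-- **at a `D₁₂` place the printed vector `1` is fixed by every compact letter**: `unitaryOpPi U (binvPi 1) = binvPi 1` — with #9 the torus
acts on it by the scalar `vacScalar e_b k` only. [Folland1989, Prop. (4.39)] -/
theorem unitaryOpPi_binvPi_one (U : Matrix.unitaryGroup (DPIdx P' Q' R' S') ℂ) :
    unitaryOpPi U (binvPi (1 : MvPolynomial (DPIdx P' Q' R' S') ℂ)) = binvPi 1 := by
  rw [unitaryOpPi_binvPi, linSubst_one]

end IotaDict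

end HodgeCM.Model.HypCensus

end
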